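import Summits.QuantumFields.BalabanUV.Beta.EriceFlowEnclosureB12AsPrintedPointwiseFadingOrderSharpWitnessEnd

/-!
# Beta / EriceFlowEnclosureB12AsPrintedPointwiseFadingOrderSharpThreshold — WHAT (0.31) FORCES POINTWISE, part 7♯, THE THRESHOLD THEOREM.  The four gen-45
# modules (`…Sharp`, `…SharpOscillation`, `…SharpWitness`, `…SharpWitnessEnd`) assembled into ONE `iff` and its Markov endpoint:
#
# **`orderBox_iff`** — for a fading rate 0 < θ < 1 and a number c, the following are equivalent:
#   (i) for EVERY constant C ≥ 0, box ]0, γ] with Cγ³ ≤ c, moduli Λ with `FadingMemory C θ Λ`, history-dependent β with `HistLipschitz Λ γ β`, depth K and pair of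
#       in-box runs of (0.20) of length K: g_0 < g′_0 ⟹ g_j < g′_j at every scale j ≤ K (ORDER of the bare couplings = order of the effective couplings —
#       hence «g₀ = g₀(ε, g)» strictly increasing, same-length uniqueness, the typed «∃! g₀»);
#   (ii) **c ≤ 2(1 − √θ)²**.
# (ii) ⟹ (i) is `…Sharp.order_preserved_sqrt` (forward separation, ratio √θ); ¬(ii) ⟹ ¬(i) is `…SharpWitnessEnd.order_reversal_above_edge` (the clamp family: above the
# edge the discrepancy recursion IS the oscillating comparison recursion).  At θ = 0 (last-only moduli, `FadingMemory C 0 Λ`): order for Cγ³ < 2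
# (`…Sharp.order_preserved_markov`) and **`order_reversal_markov_edge`** — for every c > 2 a last-only clamp family with Cγ³ ≤ c whose run started just below 1
# jumps ABOVE the constant run in ONE step (row U's Markov fold edge, reached from the order side; the single value c = 2 is left open here).
# READING (ours): the number prover 1 conjectured as the asymptotics of the sharp reference-free threshold (bflow-p1 gen 35 NEXT (A): «(1−θ)²∕4 ≤ t(θ) … ≍ 2(1−√θ)²»)
# is, for ORDER, the EXACT threshold at every 0 < θ < 1; for UNIQUENESS it is the exact edge of both comparison methods (`…SharpOscillation` §1) and hence the
# lower bound t(θ) ≥ 2(1−√θ)², prover 1's folds (#63d, #63f) remaining the upper data — whether pinned same-length runs can COINCIDE already just above 2(1−√θ)²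
# (order reversal ≠ fold) is OPEN and recorded as such
# (β-flow team, prover 2 = lower ∕ positivity side, unit `b2b-balaban-beta-bflow-p2`, gen 45; ROW AP-I × node U2's letters and `T4TwoRunUniqueness` §3)

HONEST FRAMING (page 1 of everything the β sub-cell writes): discharging `BetaPertH` makes Bałaban's UV stability UNCONDITIONAL — a
real constructive-QFT result; it is NOT the continuum limit and NOT the Clay problem.  HONEST DEPENDENCY (cell reorg 2026-08-19,
verbatim): «continuum YM on T⁴ ⇐ BetaPertH ∧ nine spine estimates (0/9 proved); BetaPertH ⇐ (D1) ∧ (D4) ∧ CAP+tail; G-an2-4 gates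
asym, D1 and NE2/3/4.»  THIS MODULE DISCHARGES NOTHING: it is elementary real analysis about two real sequences obeying the recursion (0.20) of
[I] = T. Bałaban, Commun. Math. Phys. **109** (1987) [Balaban1987RG1] p. 256 for ABSTRACT history-dependent families under node U2's UNPRINTED hypothesis
shapes `HistLipschitz` ∕ `FadingMemory` (GAPS G-t4-U2-2; p. 298), and about one explicit TOY family of ours.  Nothing about Bałaban's β is asserted; order ∕
uniqueness of g₀ are NOT printed in [I] (Theorem 2 p. 259 is an existence statement, STATED WITHOUT PROOF — custodian's DELTA-I D-21).

WHAT THIS FILE PROVES (0 sorry, 0 def): **`orderBox_iff`**, **`order_reversal_markov_edge`**.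
NOT CLAIMED: the sharp constant for UNIQUENESS among all families; the boundary value c = 2 at θ = 0; anything about Bałaban's β; Theorem 2; `BetaPertH`;
continuum; Clay.
-/

namespace Summit.QuantumFields.BalabanUV.Beta.EriceFlowEnclosureB12AsPrintedPointwiseFadingOrderSharpThreshold

open Finset
open Literature.MathematicalPhysics.QuantumFieldTheory.Balaban1983to89
open Literature.MathematicalPhysics.QuantumFieldTheory.Balaban1983to89.FlowStep (HBeta prefixOf Box mem_box RGEqH)
open Literature.MathematicalPhysics.QuantumFieldTheory.Balaban1983to89.T4CouplingMatching (HistLipschitz FadingMemory)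
open Summit.QuantumFields.BalabanUV.Beta.EriceFlowEnclosureB12AsPrintedPointwiseFadingOrderSharp (order_preserved_sqrt)
open Summit.QuantumFields.BalabanUV.Beta.EriceFlowEnclosureB12AsPrintedPointwiseFadingOrderSharpWitness
open Summit.QuantumFields.BalabanUV.Beta.EriceFlowEnclosureB12AsPrintedPointwiseFadingOrderSharpWitnessEnd
  (constants_exist clampRun order_reversal_above_edge)

noncomputable section

/-- **THE THRESHOLD THEOREM FOR ORDER UNDER FADING MEMORY.**  For 0 < θ < 1 and any real c: «in EVERY box ]0, γ] with Cγ³ ≤ c, for EVERY β carrying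
`HistLipschitz Λ γ β` with `FadingMemory C θ Λ` (C ≥ 0) and EVERY pair of same-length in-box runs of (0.20), the order of the bare couplings is kept at every
scale» ⟺ **c ≤ 2(1 − √θ)²**.  ((⟸) `…Sharp.order_preserved_sqrt`; (⟹) contrapositive of `…SharpWitnessEnd.order_reversal_above_edge`.)  Sign-free, AF-free,
Theorem-2-free; the sharp box for «g₀ ↦ g_K strictly increasing» under node U2's moduli. [cite: Balaban1987RG1, (0.20) p.256 with p.298 and Thm 2 p.259 («g₀ = g₀(ε, g)»)] -/
theorem orderBox_iff {θ c : ℝ} (hθ0 : 0 < θ) (hθ1 : θ < 1) :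
    (∀ (C γ : ℝ) (Λ : ℕ → ℕ → ℝ) (β : HBeta) (K : ℕ) (g g' : ℕ → ℝ),
        0 ≤ C → C * γ ^ 3 ≤ c → FadingMemory C θ Λ → HistLipschitz Λ γ β → RGEqH K β g → RGEqH K β g' →
        (∀ i, i ≤ K → 0 < g i ∧ g i ≤ γ) → (∀ i, i ≤ K → 0 < g' i ∧ g' i ≤ γ) →
        g 0 < g' 0 → ∀ j, j ≤ K → g j < g' j)
      ↔ c ≤ 2 * (1 - Real.sqrt θ) ^ 2 := by
  constructor
  · intro h
    by_contra hlt
    have hc : 2 * (1 - Real.sqrt θ) ^ 2 < c := lt_of_not_ge hlt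
    obtain ⟨C, γ, Λ, β, K, g, g', hC, -, hCγ, hΛ, hL, hg, hg', hb, hb', h0, hnot⟩ :=
      order_reversal_above_edge hθ0 hθ1 hc
    exact hnot (h C γ Λ β K g g' hC hCγ hΛ hL hg hg' hb hb' h0)
  · intro hc C γ Λ β K g g' hC hCγ hΛ hL hg hg' hb hb' h0
    exact order_preserved_sqrt hθ0 hθ1 hC hg hg' hb hb' hL hΛ (hCγ.trans hc) h0

/-- **THE MARKOV EDGE FROM THE ORDER SIDE** (θ = 0).  For every c > 2 there are C ≥ 0, γ > 0 with Cγ³ ≤ c, LAST-ONLY moduli (`FadingMemory C 0 Λ`, Λ k i = C·0^{k−i}),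
a β with `HistLipschitz Λ γ β` (the clamp family at θ = 0: β_{k+1}(g_{≤k}) = C·φ_τ(1 − g_k), Markov), and two runs of (0.20) of length 1 inside ]0, γ] — g′ ≡ 1 and g
started just below 1 — with g_0 < g′_0 and g′_1 < g_1: ONE step reverses the order (1∕g_1² − 1 = (1 − C·g_0²∕(1+g_0))(1∕g_0² − 1) with C·g_0²∕(1+g_0) > 1).  Complements
`…Sharp.order_preserved_markov` (order for Cγ³ < 2); the value c = 2 itself is not decided here. [cite: Balaban1987RG1, (0.20) p.256 with §1 p.264] -/
theorem order_reversal_markov_edge {c : ℝ} (hc : 2 < c) :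
    ∃ (C γ : ℝ) (Λ : ℕ → ℕ → ℝ) (β : HBeta) (g g' : ℕ → ℝ),
      0 ≤ C ∧ 0 < γ ∧ C * γ ^ 3 ≤ c ∧ FadingMemory C 0 Λ ∧ HistLipschitz Λ γ β ∧
      RGEqH 1 β g ∧ RGEqH 1 β g' ∧ (∀ i, i ≤ 1 → 0 < g i ∧ g i ≤ γ) ∧ (∀ i, i ≤ 1 → 0 < g' i ∧ g' i ≤ γ) ∧
      g 0 < g' 0 ∧ g' 1 < g 1 := by
  have hc' : 2 * (1 - Real.sqrt 0) ^ 2 < c := by rw [Real.sqrt_zero]; linarith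
  obtain ⟨C, τ, hC0, hτ0, hτ4, hCγ, hcm⟩ := constants_exist hc'
  rw [Real.sqrt_zero, sub_zero, one_pow] at hcm
  -- the (Markov) clamp family at θ = 0
  let βt : HBeta := fun k p => C * ∑ i : Fin (k + 1), (0 : ℝ) ^ (k - (i : ℕ)) * max (-τ) (min τ (1 - p i))
  have hβ : ∀ (k : ℕ) (p : Fin (k + 1) → ℝ),
      βt k p = C * ∑ i : Fin (k + 1), (0 : ℝ) ^ (k - (i : ℕ)) * max (-τ) (min τ (1 - p i)) := fun _ _ => rfl
  set M : ℝ := 1 + 2 * C / (1 - 0) with hM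
  have hMpos : 0 < M := by
    have : 0 ≤ 2 * C / (1 - 0) := div_nonneg (by linarith) (by norm_num)
    rw [hM]; linarith
  have hM1 : 1 ≤ M := by
    have : 0 ≤ 2 * C / (1 - 0) := div_nonneg (by linarith) (by norm_num)
    rw [hM]; linarith
  have hMN : 0 < M ^ 1 := pow_pos hMpos _
  set δ₀ : ℝ := τ / (2 * M ^ 1) with hδ₀
  have hδ : 0 < δ₀ := by rw [hδ₀]; positivity
  have hN : M ^ 1 * δ₀ ≤ τ / 2 := by
    rw [hδ₀, mul_div_assoc', mul_comm (M ^ 1) τ, mul_div_mul_right _ _ hMN.ne']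
  let tbl : ℕ → ℕ → ℝ := fun k => Nat.rec (motive := fun _ => ℕ → ℝ) (fun _ => 1 / Real.sqrt (1 + δ₀))
      (fun k t i => if i ≤ k then t i else 1 / Real.sqrt (1 / (t k) ^ 2 - βt k (fun j : Fin (k + 1) => t j))) k
  have hcs : ∀ (k i : ℕ), tbl (k + 1) i =
      if i ≤ k then tbl k i else 1 / Real.sqrt (1 / (tbl k k) ^ 2 - βt k (fun j : Fin (k + 1) => tbl k j)) :=
    fun _ _ => rfl
  have h0 : tbl 0 0 = 1 / Real.sqrt (1 + δ₀) := rfl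
  obtain ⟨hin, hrg⟩ := clampRun hβ hC0.le le_rfl zero_lt_one (by linarith) hM hδ hN hcs h0
  have hpos : ∀ i, i ≤ 1 → 0 < tbl i i := fun i hi => (hin i hi).1
  have hband : ∀ i, i ≤ 1 → |1 - tbl i i| ≤ τ := fun i hi =>
    (abs_one_sub_le_of_inv_sq (hpos i hi) (by linarith)
      (((hin i hi).2.trans (mul_le_mul_of_nonneg_right (pow_le_pow_right₀ hM1 hi) hδ.le)).trans hN)).trans
      (by linarith)
  obtain ⟨hs0, hs1, hsD⟩ := start_facts hδ
  -- the one step: D_1 = (1 − C w_0) D_0 < 0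
  have hD0 : 0 < 1 / (tbl 0 0) ^ 2 - 1 := by rw [h0, hsD]; exact hδ
  have hrec0 := band_recursion hβ hrg hpos hband (k := 0) zero_lt_one
  rw [Finset.sum_range_one, Nat.sub_zero, pow_zero, one_mul] at hrec0
  have hcl : C * ((1 - τ) ^ 2 / (2 + τ)) ≤ C * ((tbl 0 0) ^ 2 / (1 + tbl 0 0)) :=
    mul_le_mul_of_nonneg_left (coeff_lower (by linarith) (hband 0 (Nat.zero_le _))) hC0.le
  have hD1 : 1 / (tbl (0 + 1) (0 + 1)) ^ 2 - 1 < 0 := by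
    rw [hrec0]
    nlinarith [mul_lt_mul_of_pos_right (lt_of_lt_of_le hcm hcl) hD0]
  have h1 : 1 < tbl 1 1 := by
    have hp1 := hpos 1 le_rfl
    have hsq : 1 ^ 2 < (tbl 1 1) ^ 2 := by
      have h := hD1
      simp only [Nat.zero_add] at h
      have : 1 / (tbl 1 1) ^ 2 < 1 := by linarith
      rw [div_lt_one (by positivity)] at this
      simpa using this
    exact lt_of_pow_lt_pow_left₀ 2 hp1.le hsq
  refine ⟨C, 1 + τ, fun k i => C * (0 : ℝ) ^ (k - i), βt, fun k => tbl k k, fun _ => 1, hC0.le, by linarith, hCγ,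
    fadingMemory_clamp hC0.le le_rfl, histLipschitz_clamp hβ hC0.le le_rfl _, hrg, rgEqH_const hβ hτ0.le _,
    fun i hi => ⟨hpos i hi, by linarith [(abs_le.mp (hband i hi)).1]⟩, fun i _ => ⟨one_pos, by linarith⟩, ?_, h1⟩
  show tbl 0 0 < 1
  rw [h0]; exact hs1

end

end Summit.QuantumFields.BalabanUV.Beta.EriceFlowEnclosureB12AsPrintedPointwiseFadingOrderSharpThreshold
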